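import Mathlib.Topology.Algebra.Category.ProfiniteGrp.Basic
import Mathlib.Topology.Instances.ZMod
import Literature.IUT.HodgeTheaters.PuncturedEllipticCoveringsCusps
import Literature.IUT.HodgeTheaters.PuncturedEllipticArrowModelLift
import Literature.IUT.HodgeTheaters.PuncturedEllipticArrowModelGalois
import HarnessLib

/-!
# The finite model of [IUTchI] §1, part 5: the `PuncturedEllipticData` and ALL §1 claims at once (witness)

Mochizuki, *Inter-universal Teichmüller theory I*, kurims manuscript (May 2020), §1 pp. 37–40
([IUTchI] §1 p.38) [claim: Mochizuki2012, status: disputed] (D-0012 claim key; series status DISPUTED —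
WITNESS-class module (`<Interface>NonVacuityWitness`-type content): a finite model; nothing of the series is
asserted, no side is taken on [IUTchIII] Cor. 3.12).

ANSWER to the WITNESS GAP «NV-1» (abc-iut-L5-t8 g4, 05:41Z: "no inhabitant in the tree at which
`ArrowCoveringClaims` fires" — the frozen `TrivialModel.toyDatum` has `[Π_X : Π_X̲] = 1`, and abc-iut-S2's
`ThetaGeometryModel.pedOf` REFUTES the claims).  Here, for EVERY `l ≥ 5` prime to `6`, the model
`Π_C = N ⋊ D_l` of abc-iut-L5-t1 (parts 1–4, `G_k = 1`, discrete) is packaged as a `PuncturedEllipticData`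
(`ArrowModel.datum`) for which SIMULTANEOUSLY (`ArrowModel.exists_sectionOne_model`):
* `ArrowCoveringClaims` (F-2586; the thirteen clauses of pp. 37–38: `jKer ⊴ Π_C̲`, `[Δ_X̲ : jKer] = l`,
  `I_{ε′}·jKer = I_{ε″}·jKer = Δ_X̲`, `Π_{X̲→} ∩ Δ = jKer`, `Π_{X̲→} ↠ G_k`, the cartesian square,
  normal images, `[Π_C̲ : Π_{X̲→}] = 2l`, `[Π_C̲ : Π_{C̲→}] = l`, cyclic Galois groups) — COMPUTED from the §1
  construction: `modLKer = 1`, `deltaEpsKer = ⨆_{x ∉ {0,±1}} D_x`, `jKer = K`, `Π_{X̲→} = K`, `galKer = Π_{C̲→} = K′`;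
* `Rmk121` (normalisers `= Π_C̲`, orders `2l`, `l`);
* the companion `CuspGalois` (abc-iut-L5-t1 p424023) and `ArrowOpenClaims`;
* the Def. 3.1 (d) numerics of abc-iut-L5-t2's `ThetaGeometry`: `[Π_X : Π_X̲] = l`, `[Π_C̲ : Π_X̲] = 2`,
  `Π_C̲ ⊄ Π_X`, `Π_X̲ ↠ G_k`.
So the typed §1 predicates are JOINTLY SATISFIABLE with non-degenerate cusps (honest scope: `G_k = 1` here;
the `G_K × (N ⋊ D_l)` packaging into a `ThetaGeometry` is the natural sequel).  No `sorry`, no instance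
declared, symbolic `l`; axioms standard.
-/

namespace Literature.IUT.HodgeTheaters

namespace PuncturedEllipticData

namespace ArrowModel

open Literature.AnabelianGeometry.AbsoluteAnabelian DihedralGroup
open scoped Pointwise

variable (l : ℕ)

/-! ### Profinite packaging (`G_k = 1`, discrete) -/

/-- `Π_C = N ⋊ D_l` as a (finite, discrete) profinite group. [claim: Mochizuki2012, status: disputed] -/
noncomputable abbrev arithGrp [NeZero l] : ProfiniteGrp.{0} :=
  ProfiniteGrp.ofFiniteGrp (@FiniteGrp.of (G l) _ (finite_G l))

/-- The topology of `Π_C` is discrete. [claim: Mochizuki2012, status: disputed] -/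
theorem discreteTopology_arithGrp [NeZero l] : DiscreteTopology (arithGrp l) := ⟨rfl⟩

/-- The trivial Galois group `G_k = 1`. [claim: Mochizuki2012, status: disputed] -/
abbrev Gal : Type := Multiplicative (ZMod 1)

/-- The augmentation `Π_C ↠ G_k = 1`. [claim: Mochizuki2012, status: disputed] -/
noncomputable def augm [NeZero l] : arithGrp l →ₜ* ProfiniteGrp.of Gal where
  toFun _ := 1
  map_one' := rfl
  map_mul' _ _ := (mul_one _).symm
  continuous_toFun := continuous_const

/-- The extension `Π_C ↠ G_k`. [claim: Mochizuki2012, status: disputed] -/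
noncomputable abbrev ext [NeZero l] : FundamentalExtension.{0} where
  arith := arithGrp l
  gal := ProfiniteGrp.of Gal
  aug := augm l
  aug_surjective _ := ⟨1, Subsingleton.elim _ _⟩

/-- `Δ_C = Π_C`. [claim: Mochizuki2012, status: disputed] -/
theorem geom_eq_top [NeZero l] : (ext l).geom = ⊤ := by
  ext x
  simp only [Subgroup.mem_top, iff_true]
  exact Subsingleton.elim _ _

/-! ### The datum -/

/-- **The §1 model datum** (`l ≥ 5` prime to `6`): `Π_C = N ⋊ D_l ↠ 1`, `Π_X = N ⋊ ⟨r⟩`, `Π_C̲ = N ⋊ ⟨s⟩`,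
cusps `ℤ/l` with `D_i = ⟨(c_i, 1)⟩`, `c_i = B_{i+1} − B_i`, and `ε⁰, ε′, ε″, 2ε := 0, 1, −1, 2`.
([IUTchI] §1 p.37) [claim: Mochizuki2012, status: disputed] -/
noncomputable abbrev datum (h5 : 5 ≤ l) (h6 : Nat.Coprime l 6) : PuncturedEllipticData.{0} :=
  haveI : NeZero l := ⟨by omega⟩
  { l := l
    five_le := h5
    coprime_six := h6
    E := ext l
    PiX := PiXm l
    PiCbar := PiCbarm l
    isOpen_piX := @isOpen_discrete _ _ (discreteTopology_arithGrp l) _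
    isOpen_piCbar := @isOpen_discrete _ _ (discreteTopology_arithGrp l) _
    index_piX := index_PiXm l
    aug_piX := fun _ => ⟨1, Subsingleton.elim _ _⟩
    aug_piCbar := fun _ => ⟨1, Subsingleton.elim _ _⟩
    star := by
      intro g hg x hx
      have hg' : g ∈ PiXm l ⊓ (ext l).geom := ⟨hg, by rw [geom_eq_top]; trivial⟩
      refine Subgroup.le_topologicalClosure _ (Subgroup.mem_sup_left ?_)
      rw [← commutatorElement_def]
      exact Subgroup.commutator_mem_commutator hg' hx
    Cusp := ZMod l
    decomp := Dm l
    decomp_le := fun i g hg => by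
      have h : g ∈ PiXm l ⊓ PiCbarm l := by rw [PiXm_inf_PiCbarm]; exact Dm_le_Nhat l i hg
      exact h
    ε0 := 0
    ε1 := 1
    ε2 := -1
    twoε := 2
    ε1_ne_ε0 := (cusp_facts_of_five_le l h5).1
    ε2_ne_ε0 := (cusp_facts_of_five_le l h5).2.1
    ε1_ne_ε2 := (cusp_facts_of_five_le l h5).2.2.1
    twoε_ne := (cusp_facts_of_five_le l h5).2.2.2
    aug_decomp_twoε := fun _ => ⟨1, Subsingleton.elim _ _⟩ }

/-! ### The §1 construction computed in the model -/

section Identify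

variable {l} (h5 : 5 ≤ l) (h6 : Nat.Coprime l 6)

/-- `l` is odd (it is prime to `6`). [claim: Mochizuki2012, status: disputed] -/
theorem odd_of_coprime_six (h6 : Nat.Coprime l 6) : Odd l :=
  Nat.coprime_two_right.mp (Nat.Coprime.coprime_dvd_right (show 2 ∣ 6 by norm_num) h6)

/-- `Π_X̲ = N`. [claim: Mochizuki2012, status: disputed] -/
theorem piXbar_eq : (datum l h5 h6).PiXbar = Nhat l := PiXm_inf_PiCbarm l

/-- `Δ_C = Π_C`. [claim: Mochizuki2012, status: disputed] -/
theorem deltaC_eq_top : (datum l h5 h6).DeltaC = ⊤ := by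
  haveI : NeZero l := ⟨by omega⟩
  exact geom_eq_top l

/-- `Δ_X̲ = N`. [claim: Mochizuki2012, status: disputed] -/
theorem deltaXbar_eq : (datum l h5 h6).DeltaXbar = Nhat l := by
  show (datum l h5 h6).PiXbar ⊓ (datum l h5 h6).DeltaC = _
  rw [deltaC_eq_top, inf_top_eq, piXbar_eq]

/-- `Δ_C̲ = Π_C̲`. [claim: Mochizuki2012, status: disputed] -/
theorem deltaCbar_eq : (datum l h5 h6).DeltaCbar = PiCbarm l := by
  show (datum l h5 h6).PiCbar ⊓ (datum l h5 h6).DeltaC = _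
  rw [deltaC_eq_top, inf_top_eq]

/-- `I_x = D_x` (`G_k = 1`). [claim: Mochizuki2012, status: disputed] -/
theorem inertia_eq (x : ZMod l) : (datum l h5 h6).inertia x = Dm l x := by
  show (datum l h5 h6).decomp x ⊓ (datum l h5 h6).DeltaC = _
  rw [deltaC_eq_top, inf_top_eq]

/-- `modLKer = 1` (`Δ_X̲ = N` is already elementary abelian of exponent `l`; discrete topology).
([IUTchI] §1 p.37) [claim: Mochizuki2012, status: disputed] -/
theorem modLKer_eq_bot : (datum l h5 h6).modLKer = ⊥ := by
  haveI : NeZero l := ⟨by omega⟩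
  refine le_antisymm ?_ bot_le
  unfold PuncturedEllipticData.modLKer
  refine Subgroup.topologicalClosure_minimal _ (sup_le ?_ ?_)
    (@isClosed_discrete _ _ (discreteTopology_arithGrp l) _)
  · rw [deltaXbar_eq]
    exact le_of_eq (commutator_Nhat_eq_bot l)
  · rw [deltaXbar_eq]
    exact le_of_eq (closure_pow_Nhat_eq_bot l)

/-- `deltaEpsKer = ⨆_{x ∉ {0, ±1}} D_x`. ([IUTchI] §1 p.37) [claim: Mochizuki2012, status: disputed] -/
theorem deltaEpsKer_eq : (datum l h5 h6).deltaEpsKer = EpsSup l := by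
  show (datum l h5 h6).modLKer ⊔ (⨆ x : {x : ZMod l // x ≠ 0 ∧ x ≠ 1 ∧ x ≠ -1},
    (datum l h5 h6).inertia x.1) = _
  rw [modLKer_eq_bot, bot_sup_eq]
  exact iSup_congr fun x => inertia_eq h5 h6 x.1

/-- **`jKer = K`** (`= Ker(Δ_X̲ ↠ Δ_ε⁺)`). ([IUTchI] §1 p.38) [claim: Mochizuki2012, status: disputed] -/
theorem jKer_eq : (datum l h5 h6).jKer = Khat l := by
  haveI : NeZero l := ⟨by omega⟩
  obtain ⟨q, hq⟩ := odd_of_coprime_six h6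
  show (datum l h5 h6).deltaEpsKer ⊔ Subgroup.closure {z | ∃ x ∈ (datum l h5 h6).DeltaXbar,
    ∃ c ∈ (datum l h5 h6).DeltaCbar, c ∉ (datum l h5 h6).DeltaXbar ∧ z = x * c * x⁻¹ * c⁻¹} = _
  rw [deltaEpsKer_eq, deltaXbar_eq, deltaCbar_eq]
  exact sup_closure_commSet_eq_Khat l hq (by omega)

/-- **`Π_{X̲→} = K`** (`D_{2ε} ≤ jKer` as `2 ∉ {0, ±1}`). ([IUTchI] §1 p.38) [claim: Mochizuki2012, status: disputed] -/
theorem piXarrow_eq : (datum l h5 h6).piXarrow = Khat l := by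
  show (datum l h5 h6).decomp 2 ⊔ (datum l h5 h6).jKer = _
  rw [jKer_eq]
  exact sup_eq_right.mpr
    (Dm_le_Khat l (cusp_facts_of_five_le l h5).2.2.2.1 (cusp_facts_of_five_le l h5).2.2.2.2.1 (cusp_facts_of_five_le l h5).2.2.2.2.2)

/-- **`galKer = K′`**. ([IUTchI] §1 p.38) [claim: Mochizuki2012, status: disputed] -/
theorem galKer_eq : (datum l h5 h6).galKer = Khat' l := by
  obtain ⟨q, hq⟩ := odd_of_coprime_six h6
  show (datum l h5 h6).jKer ⊔ Subgroup.closure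
    ((fun y : (datum l h5 h6).PiC => y ^ l) '' ((datum l h5 h6).DeltaCbar : Set _)) = _
  rw [jKer_eq, deltaCbar_eq]
  exact Khat_sup_closure_powSet_eq l hq

/-- **`Π_{C̲→} = K′`**. ([IUTchI] §1 p.38) [claim: Mochizuki2012, status: disputed] -/
theorem piCarrow_eq : (datum l h5 h6).piCarrow = Khat' l := by
  show (datum l h5 h6).decomp 2 ⊔ (datum l h5 h6).galKer = _
  rw [galKer_eq]
  exact sup_eq_right.mpr ((Dm_le_Khat l (cusp_facts_of_five_le l h5).2.2.2.1 (cusp_facts_of_five_le l h5).2.2.2.2.1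
    (cusp_facts_of_five_le l h5).2.2.2.2.2).trans (Khat_le_Khat' l))

end Identify

/-! ### ALL the §1 claims hold in the model -/

section Claims

variable {l} (h5 : 5 ≤ l) (h6 : Nat.Coprime l 6)

/-- **`ArrowCoveringClaims` holds for the model datum** — every clause of pp. 37–38 as typed.
([IUTchI] §1 p.38) [claim: Mochizuki2012, status: disputed] -/
theorem arrowCoveringClaims : (datum l h5 h6).ArrowCoveringClaims := by
  haveI : NeZero l := ⟨by omega⟩
  have h2 : 2 ≤ l := by omega
  have h3 : 3 ≤ l := by omega
  have hodd := odd_of_coprime_six h6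
  have cycX : ∀ P : Subgroup (G l), P = Khat l →
      ∀ [(P.subgroupOf (PiCbarm l)).Normal], IsCyclic (PiCbarm l ⧸ P.subgroupOf (PiCbarm l)) := by
    rintro P rfl _; exact isCyclic_quot_Khat l h2 hodd
  have cycC : ∀ P : Subgroup (G l), P = Khat' l →
      ∀ [(P.subgroupOf (PiCbarm l)).Normal], IsCyclic (PiCbarm l ⧸ P.subgroupOf (PiCbarm l)) := by
    rintro P rfl _; exact isCyclic_quot_Khat' l h2
  exact
  { jKer_normal := by rw [jKer_eq]; exact normal_Khat_subgroupOf_PiCbarm l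
    jKer_relindex := by rw [jKer_eq, deltaXbar_eq]; exact relIndex_Khat_Nhat l h2
    inertia_ε1_sup := by rw [inertia_eq, jKer_eq, deltaXbar_eq]; exact Dm_one_sup_Khat l h3
    inertia_ε2_sup := by rw [inertia_eq, jKer_eq, deltaXbar_eq]; exact Dm_neg_one_sup_Khat l h3
    piXarrow_inf_delta := by rw [piXarrow_eq, deltaC_eq_top, inf_top_eq, jKer_eq]
    aug_piXarrow := fun _ => ⟨1, Subsingleton.elim _ _⟩
    cartesian := by rw [piXarrow_eq, piXbar_eq, piCarrow_eq]; exact (Nhat_inf_Khat' l).symm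
    piXarrow_normal := by rw [piXarrow_eq]; exact normal_Khat_subgroupOf_PiCbarm l
    piCarrow_normal := by rw [piCarrow_eq]; exact normal_Khat'_subgroupOf_PiCbarm l
    piXarrow_relindex := by rw [piXarrow_eq]; exact relIndex_Khat_PiCbarm l h2
    piCarrow_relindex := by rw [piCarrow_eq]; exact relIndex_Khat'_PiCbarm l h2
    galX_cyclic := @cycX _ (piXarrow_eq h5 h6)
    galC_cyclic := @cycC _ (piCarrow_eq h5 h6) }

/-- **Remark 1.2.1 holds for the model datum**: `N_{Π_C}(Π_{X̲→}) = N_{Π_C}(Π_{C̲→}) = Π_C̲`, orders `2l`, `l`.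
([IUTchI] Rmk 1.2.1 p.40) [claim: Mochizuki2012, status: disputed] -/
theorem rmk121 : (datum l h5 h6).Rmk121 := by
  haveI : NeZero l := ⟨by omega⟩
  have h2 : 2 ≤ l := by omega
  have h3 : 3 ≤ l := by omega
  exact
  { normalizer_piXarrow := by rw [piXarrow_eq]; exact normalizer_Khat l h3
    normalizer_piCarrow := by rw [piCarrow_eq]; exact normalizer_Khat' l h3
    card_galX := by rw [piXarrow_eq]; exact relIndex_Khat_PiCbarm l h2
    card_galC := by rw [piCarrow_eq]; exact relIndex_Khat'_PiCbarm l h2 }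

/-- **The model datum carries the companion `CuspGalois` structure** (cusp action through `D_l`).
([IUTchI] §1 p.37) [claim: Mochizuki2012, status: disputed] -/
noncomputable def cuspGalois : (datum l h5 h6).CuspGalois :=
  haveI : NeZero l := ⟨by omega⟩
  { act := actm l
    act_decomp := act_decomp_aux l
    eq_of_conj := eq_of_conj_aux l (by omega)
    isClosed_decomp := fun _ => @isClosed_discrete _ _ (discreteTopology_arithGrp l) _
    free := free_aux l
    transitive := transitive_aux l
    exists_generator := generator_aux l
    conj_mul_mem_PiXbar := conj_aux l
    act_ε0 := act0_aux l
    act_ε1 := act1_aux l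
    act_twoε := act2_aux l }

/-- The model datum satisfies `ArrowOpenClaims` (discrete topology). ([IUTchI] §1 p.38)
[claim: Mochizuki2012, status: disputed] -/
theorem arrowOpenClaims : (datum l h5 h6).ArrowOpenClaims := by
  haveI : NeZero l := ⟨by omega⟩
  exact ⟨@isOpen_discrete _ _ (discreteTopology_arithGrp l) _,
    @isOpen_discrete _ _ (discreteTopology_arithGrp l) _⟩

/-- The Def. 3.1 (d) numerics for the model datum: `[Π_X : Π_X̲] = l`, `[Π_C̲ : Π_X̲] = 2`, `Π_C̲ ⊄ Π_X`,
`Π_X̲ ↠ G_k`. ([IUTchI] Def 3.1(d) p.62) [claim: Mochizuki2012, status: disputed] -/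
theorem thetaNumerics :
    (datum l h5 h6).PiXbar.relIndex (datum l h5 h6).PiX = l ∧
      (datum l h5 h6).PiXbar.relIndex (datum l h5 h6).PiCbar = 2 ∧
      ¬ (datum l h5 h6).PiCbar ≤ (datum l h5 h6).PiX ∧
      Function.Surjective ((datum l h5 h6).E.aug.toMonoidHom.comp (datum l h5 h6).PiXbar.subtype) := by
  haveI : NeZero l := ⟨by omega⟩
  exact ⟨relIndex_inf_PiXm l, relIndex_inf_PiCbarm l, not_PiCbarm_le_PiXm l,
    fun _ => ⟨1, Subsingleton.elim _ _⟩⟩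

end Claims

/-- **JOINT NON-VACUITY of the typed §1** (witness for NV-1): for every `l ≥ 5` prime to `6` there is a
`PuncturedEllipticData` with that `l` satisfying SIMULTANEOUSLY `ArrowCoveringClaims`, `Rmk121`,
`ArrowOpenClaims`, carrying a `CuspGalois` structure, and meeting the Def. 3.1 (d) numerics
`[Π_X : Π_X̲] = l`, `[Π_C̲ : Π_X̲] = 2`, `Π_C̲ ⊄ Π_X`, `Π_X̲ ↠ G_k`.  (Finite model `N ⋊ D_l`, `G_k = 1` — a
consistency witness for the typed predicates, not the arithmetic object.)
([IUTchI] §1 p.38) [claim: Mochizuki2012, status: disputed] -/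
theorem exists_sectionOne_model (h5 : 5 ≤ l) (h6 : Nat.Coprime l 6) :
    ∃ D : PuncturedEllipticData.{0}, D.l = l ∧ D.ArrowCoveringClaims ∧ D.Rmk121 ∧ D.ArrowOpenClaims ∧
      Nonempty D.CuspGalois ∧ D.PiXbar.relIndex D.PiX = l ∧ D.PiXbar.relIndex D.PiCbar = 2 ∧
      ¬ D.PiCbar ≤ D.PiX ∧ Function.Surjective (D.E.aug.toMonoidHom.comp D.PiXbar.subtype) :=
  ⟨datum l h5 h6, rfl, arrowCoveringClaims h5 h6, rmk121 h5 h6, arrowOpenClaims h5 h6, ⟨cuspGalois h5 h6⟩,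
    thetaNumerics h5 h6⟩

/-- Instance at `l = 5`. ([IUTchI] §1 p.38) [claim: Mochizuki2012, status: disputed] -/
theorem exists_sectionOne_model_five :
    ∃ D : PuncturedEllipticData.{0}, D.l = 5 ∧ D.ArrowCoveringClaims ∧ D.Rmk121 ∧ D.ArrowOpenClaims ∧
      Nonempty D.CuspGalois ∧ D.PiXbar.relIndex D.PiX = 5 ∧ D.PiXbar.relIndex D.PiCbar = 2 ∧
      ¬ D.PiCbar ≤ D.PiX ∧ Function.Surjective (D.E.aug.toMonoidHom.comp D.PiXbar.subtype) :=
  exists_sectionOne_model 5 le_rfl (by decide)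

end ArrowModel

end PuncturedEllipticData

end Literature.IUT.HodgeTheaters
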